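import Mathlib.Analysis.SpecialFunctions.Complex.LogDeriv
import Mathlib.Analysis.SpecialFunctions.Complex.Arg
import Mathlib.Analysis.Calculus.ContDiff.RCLike
import Mathlib.Analysis.InnerProductSpace.PiL2
import Mathlib.Geometry.Manifold.Instances.Real

/-!
# Helper `helper_handlebodyChart_modelHandles` (M3: handle structure of the model dotted handlebody `D_k`)
# of line `mk_friends` for crux `DcrGap` — swept angles of straight moves
(item stmt-SmoothPoincare4-16128, route route-SmoothPoincare4-DottedCircleRasmussen)

**Registered piece `helper_handlebodyChart_modelHandles_segmentPhase` of the model lemma M3.**  The squeeze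
hypothesis of the registered reduction `helper_handlebodyChart_modelHandles_of_data` asks every squeeze
`κ` of `D_k` to come with smooth lifts `SW_l` of the angles its planar shadows sweep about the hole
centres `c_l`: `u(z(κ x) - c_l) = e^{i SW_l(x)} u(z(x) - c_l)`, `u(v) = v/|v|`.  For the radial factors
of the squeeze (pushes moving the shadow `z` along a straight segment, `…ModelHandlesRadial.lean`) this
datum is the principal argument of the ratio of the two offsets: if the segment from `Z₀ x` to `Z₁ x`
misses `c` then `(Z₁ x - c)/(Z₀ x - c)` lies in the slit plane (`ModelHandles.div_sub_mem_slitPlane_of_segment`),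
where the principal argument is real-analytic; so on the open set where this holds,
`SW = arg ((Z₁ - c)/(Z₀ - c))` is smooth and lifts the swept angle (`ModelHandles.segment_sweptAngle`,
stated for shadows `Z₀, Z₁ : E → ℂ` on any real normed space).  Swept angles of composed moves add.

No definitions, no named facts, no `sorry`.

References: M. W. Hirsch, *Differential Topology* (1976), Ch. 8 §1 [HirschDT1976].
-/

-- the prescribed namespace `Summit.<P>.<Sub>.…` duplicates `SmoothPoincare4` (P = Sub)
set_option linter.dupNamespace false
set_option linter.style.longLine false

noncomputable section

open scoped ContDiff Topology
open Function Set Metric Filter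

namespace Summit.SmoothPoincare4.SmoothPoincare4.Theorems.DcrGap.MkFriends

namespace ModelHandles

/-- **Straight moves sweep a principal angle**: if the segment from `z` to `z'` misses `c`, the ratio
`(z' - c)/(z - c)` lies in the slit plane (it is a nonpositive real only if `c` divides the segment
internally). [folklore] -/
theorem div_sub_mem_slitPlane_of_segment {z z' c : ℂ}
    (h : ∀ s : ℝ, 0 ≤ s → s ≤ 1 → z + (s : ℂ) * (z' - z) ≠ c) :
    (z' - c) / (z - c) ∈ Complex.slitPlane := by
  have hz : z ≠ c := by simpa using h 0 le_rfl zero_le_one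
  have hzc : z - c ≠ 0 := sub_ne_zero.2 hz
  rw [Complex.mem_slitPlane_iff]
  by_contra hnot
  push Not at hnot
  obtain ⟨hre, him⟩ := hnot
  set r : ℂ := (z' - c) / (z - c) with hr
  -- `r` is a nonpositive real `-λ`
  set lam : ℝ := -r.re with hlam
  have hlam0 : 0 ≤ lam := by rw [hlam]; linarith
  have hrr : r = -(lam : ℂ) := by
    apply Complex.ext <;> simp [hlam, him]
  have hfac : z' - c = -(lam : ℂ) * (z - c) := by
    rw [← hrr, hr, div_mul_cancel₀ _ hzc]
  -- the point of the segment with parameter `1/(1+λ)` is `c`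
  have h1 : (0 : ℝ) < 1 + lam := by linarith
  refine h (1 / (1 + lam)) (by positivity) ((div_le_one h1).2 (by linarith)) ?_
  have e : z' - z = (z' - c) - (z - c) := by ring
  rw [e, hfac]
  have hne : (1 + (lam : ℂ)) ≠ 0 := by
    have : ((1 + lam : ℝ) : ℂ) ≠ 0 := by exact_mod_cast h1.ne'
    push_cast at this; exact this
  push_cast
  rw [div_mul_eq_mul_div, one_mul, add_div_eq_mul_add_div _ _ hne]
  rw [div_eq_iff hne]
  ring

/-- The principal argument is real-smooth on the slit plane. [folklore] -/
theorem contDiffAt_arg_of_mem_slitPlane {z : ℂ} (hz : z ∈ Complex.slitPlane) :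
    ContDiffAt ℝ ∞ Complex.arg z := by
  have h : Complex.arg = fun z => (Complex.log z).im := funext fun z => (Complex.log_im z).symm
  rw [h]
  exact Complex.imCLM.contDiff.contDiffAt.comp z ((Complex.contDiffAt_log hz).restrict_scalars ℝ)

/-- **Swept-angle lifts of straight moves.**  For smooth `Z₀, Z₁ : E → ℂ` (the planar shadows before
and after a push of `ℝ⁴` moving shadows along straight segments) and a centre `c`, on the open set `N`
where `Z₀ ≠ c` and the ratio `(Z₁ - c)/(Z₀ - c)` lies in the slit plane (which holds wherever the
segment `[Z₀ x, Z₁ x]` misses `c`, `div_sub_mem_slitPlane_of_segment`) the principal argument of the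
ratio is a smooth real function `SW` with `u(Z₁ x - c) = e^{i SW(x)} u(Z₀ x - c)` (`u(v) = v/|v|`): the
swept-angle datum the squeeze of the model handlebody has to carry. [folklore] -/
theorem segment_sweptAngle {E : Type*} [NormedAddCommGroup E] [NormedSpace ℝ E] {Z₀ Z₁ : E → ℂ}
    (hZ₀ : ContDiff ℝ ∞ Z₀) (hZ₁ : ContDiff ℝ ∞ Z₁) (c : ℂ) :
    IsOpen {x : E | Z₀ x ≠ c ∧ (Z₁ x - c) / (Z₀ x - c) ∈ Complex.slitPlane} ∧
    ContDiffOn ℝ ∞ (fun x => Complex.arg ((Z₁ x - c) / (Z₀ x - c)))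
      {x : E | Z₀ x ≠ c ∧ (Z₁ x - c) / (Z₀ x - c) ∈ Complex.slitPlane} ∧
    ∀ x ∈ {x : E | Z₀ x ≠ c ∧ (Z₁ x - c) / (Z₀ x - c) ∈ Complex.slitPlane},
      (Z₁ x - c) / ((‖Z₁ x - c‖ : ℝ) : ℂ) =
        Complex.exp ((Complex.arg ((Z₁ x - c) / (Z₀ x - c)) : ℂ) * Complex.I) *
          ((Z₀ x - c) / ((‖Z₀ x - c‖ : ℝ) : ℂ)) := by
  set N : Set E := {x : E | Z₀ x ≠ c ∧ (Z₁ x - c) / (Z₀ x - c) ∈ Complex.slitPlane} with hN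
  have hO : IsOpen {x : E | Z₀ x ≠ c} := isOpen_ne_fun hZ₀.continuous continuous_const
  refine ⟨?_, fun x hx => ?_, fun x hx => ?_⟩
  · have : N = {x : E | Z₀ x ≠ c} ∩ (fun x => (Z₁ x - c) / (Z₀ x - c)) ⁻¹' Complex.slitPlane := rfl
    rw [this]
    refine ContinuousOn.isOpen_inter_preimage ?_ hO Complex.isOpen_slitPlane
    exact (hZ₁.continuous.sub continuous_const).continuousOn.div
      (hZ₀.continuous.sub continuous_const).continuousOn fun x hx => sub_ne_zero.2 hx
  · have hz : Z₀ x - c ≠ 0 := sub_ne_zero.2 hx.1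
    have hR : ContDiffAt ℝ ∞ (fun x => (Z₁ x - c) / (Z₀ x - c)) x := by
      simp only [div_eq_mul_inv]
      exact ((hZ₁.sub contDiff_const).contDiffAt).mul (((hZ₀.sub contDiff_const).contDiffAt).inv hz)
    exact ((contDiffAt_arg_of_mem_slitPlane hx.2).comp x hR).contDiffWithinAt
  · have hz : Z₀ x - c ≠ 0 := sub_ne_zero.2 hx.1
    set R : ℂ := (Z₁ x - c) / (Z₀ x - c) with hR
    have hRne : R ≠ 0 := Complex.slitPlane_ne_zero hx.2
    have hz' : Z₁ x - c ≠ 0 := by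
      intro h0; apply hRne; rw [hR, h0, zero_div]
    have hfac : Z₁ x - c = R * (Z₀ x - c) := by rw [hR, div_mul_cancel₀ _ hz]
    have hexp : R / ((‖R‖ : ℝ) : ℂ) = Complex.exp ((Complex.arg R : ℂ) * Complex.I) := by
      have h := Complex.norm_mul_exp_arg_mul_I R
      have hn : ((‖R‖ : ℝ) : ℂ) ≠ 0 := by exact_mod_cast (norm_ne_zero_iff.2 hRne)
      rw [div_eq_iff hn, mul_comm, h]
    rw [hfac, norm_mul]
    push_cast
    rw [← hexp]
    have hn0 : ((‖Z₀ x - c‖ : ℝ) : ℂ) ≠ 0 := by exact_mod_cast (norm_ne_zero_iff.2 hz)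
    have hnR : ((‖R‖ : ℝ) : ℂ) ≠ 0 := by exact_mod_cast (norm_ne_zero_iff.2 hRne)
    field_simp

end ModelHandles

/-- **Registered piece `helper_handlebodyChart_modelHandles_segmentPhase` of the model lemma M3 (swept
angles of straight moves)**: for smooth shadows `Z₀, Z₁ : ℝ⁴ → ℂ` and a centre `c`, wherever the segment
`[Z₀ x, Z₁ x]` misses `c` the ratio `(Z₁ x - c)/(Z₀ x - c)` lies in the slit plane; the set where it does
(and `Z₀ ≠ c`) is open, the principal argument of the ratio is smooth there, and it lifts the swept angle:
`u(Z₁ x - c) = e^{i arg} u(Z₀ x - c)` (`ModelHandles.segment_sweptAngle`). [folklore] -/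
theorem helper_handlebodyChart_modelHandles_segmentPhase : ∀ (Z₀ Z₁ : EuclideanSpace ℝ (Fin 4) → ℂ), ContDiff ℝ ((⊤ : ℕ∞) : WithTop ℕ∞) Z₀ → ContDiff ℝ ((⊤ : ℕ∞) : WithTop ℕ∞) Z₁ → ∀ (c : ℂ), (∀ x, (∀ s : ℝ, 0 ≤ s → s ≤ 1 → Z₀ x + (s : ℂ) * (Z₁ x - Z₀ x) ≠ c) → x ∈ {x : EuclideanSpace ℝ (Fin 4) | Z₀ x ≠ c ∧ (Z₁ x - c) / (Z₀ x - c) ∈ Complex.slitPlane}) ∧ IsOpen {x : EuclideanSpace ℝ (Fin 4) | Z₀ x ≠ c ∧ (Z₁ x - c) / (Z₀ x - c) ∈ Complex.slitPlane} ∧ ContDiffOn ℝ ((⊤ : ℕ∞) : WithTop ℕ∞) (fun x => Complex.arg ((Z₁ x - c) / (Z₀ x - c))) {x : EuclideanSpace ℝ (Fin 4) | Z₀ x ≠ c ∧ (Z₁ x - c) / (Z₀ x - c) ∈ Complex.slitPlane} ∧ ∀ x ∈ {x : EuclideanSpace ℝ (Fin 4) | Z₀ x ≠ c ∧ (Z₁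 x - c) / (Z₀ x - c) ∈ Complex.slitPlane}, (Z₁ x - c) / ((‖Z₁ x - c‖ : ℝ) : ℂ) = Complex.exp ((Complex.arg ((Z₁ x - c) / (Z₀ x - c)) : ℂ) * Complex.I) * ((Z₀ x - c) / ((‖Z₀ x - c‖ : ℝ) : ℂ)) :=
  fun _ _ hZ₀ hZ₁ c => ⟨fun _ hx => ⟨by simpa using hx 0 le_rfl zero_le_one,
    ModelHandles.div_sub_mem_slitPlane_of_segment hx⟩, ModelHandles.segment_sweptAngle hZ₀ hZ₁ c⟩

end Summit.SmoothPoincare4.SmoothPoincare4.Theorems.DcrGap.MkFriends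

end
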